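import Summits.Ventures.Crystal3D.Theorems.StickyWulffConstantTextureLiminfTexShadowLevelReachCoSlot
import Summits.Ventures.Crystal3D.Theorems.StickyWulffConstantTextureLiminfTexShadowLevelReachCutSetShape
import Summits.Ventures.Crystal3D.Theorems.StickyWulffConstantCoaxialWallLawBarlowPlateSources
import HarnessLib

/-!
# The ROOT-CLASS census from a launch set and the BORN lines — WITH THE END-PAIR SHAPE (straight root-class endings)
# (lane T, crux `TextureLiminfV5`, stmt-Ventures-23912, registered stub `stub_terraceCensus`; (β) assembly — cross-family pooling, HOME/wall-p1-g23/BETA-PLATES-g23.md §2)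

HONEST FRAMING. Venture `Summits/Ventures/Crystal3D` (cell `crystal3d-full`), route `route-Ventures-StickyWulffConstant`, helper `--supports` the law-v5
crux `TextureLiminfV5` (stmt-Ventures-23912), lane T, mechanism (β).  Census-free, certificate-free; `KissingGap δ`, `KissingClassification δ` BY NAME; F-C1 not moved.

THE POINT.  `rootClass_endPairs_launch`, `born_endPairs_launch`, `bornMoving_endPairs_launch` (…LevelReachBorn, p744166 / p744402) VERBATIM — same
hypotheses, same proofs — over the shape-exporting `word_family_endPairs_launch_cuts_shape` (…LevelReachCutSetShape): the all-cut invariant `κ = []` is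
read back at the end ball, so the exported clause «the end ball's root predecessor is present» becomes the LINKED one
`bq.1 − F [] (u []) ∈ X ∧ bq.2 = bq.1 − F [] (u []) ∧ ¬ IsMoving X ver (F []) (F [] (u [])) bq.1`: every born-line end pair is a STRAIGHT root-class
ending in the launch frame.  This is the handle by which born-line families enter the GLOBAL POOLING (one local row for plates + born lines): families
with root directions of opposite vertical sign are disjoint outright; same-sign families reduce to the relay/born bookkeeping of BETA-CUT-g22 §4(b).
* `rootClass_endPairs_launch_shape`, **`born_endPairs_launch_shape`**, `bornMoving_endPairs_launch_shape`.
WHAT THIS IS NOT: any lower bound on the number of born lines, the pooling itself, any certificate; F-C1 not moved.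
-/

noncomputable section

namespace Summit.Ventures.Crystal3D.Theorems

open Summit.Ventures.Crystal3D Finset
open Summit.Ventures.Crystal3D.Cruxes.TextureLiminf.TexShadow (E3)
open scoped InnerProductSpace

section RootLaunch

variable {X : Finset E3} {F : List E3 → (E3 ≃ₗᵢ[ℝ] E3)} {u : List E3 → E3} {WF : List E3 → Prop} {next : List E3 → E3 → List E3}
  {P' P₂ : Finset E3} {R₀ h ρ : ℝ}

open scoped Classical in
/-- **The root-class census from a launch set, every crossing cut.**  Word data as in lane F's census; `C` cuts EVERY upward crossing letter of the root
(`hC`, `hCall`); root-frame top exclusion `hPexcl0root`; launch set `L` of straight-moving root states with predecessor (`hLsrc`, no invariant clause) and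
`p + c ∉ L` (`hLstep`); core / sealing verbatim.  Conclusion: `#L_window ≤ #T + #CUT + #REL₀ + 220·(#rim_top + #rim_bot)`, `REL₀` the STRAIGHT relaunches
only (predecessor a straight-moving window ball with its own predecessor present), `T` with lane F's exported properties (the end ball a certified root
state). -/
theorem rootClass_endPairs_launch_shape (ver : WordVersion) {δ : ℝ} (hg : KissingGap δ) (hc : KissingClassification δ)
    (hX : ∀ p ∈ X, ∀ q ∈ X, p ≠ q → 1 ≤ dist p q)
    (hFc : ∀ μ κ, F (μ :: κ) = ((ℝ ∙ μ)ᗮ.reflection).trans (F κ))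
    (hu : ∀ κ, u κ ∈ fccSlots) (huc : ∀ μ κ, u (μ :: κ) = -u κ)
    (hWF0 : WF [])
    (hWFc : ∀ μ κ, WF (μ :: κ) ↔ (WF κ ∧ ‖μ‖ = 1 ∧
      (∀ w ∈ fccSlots, ⟪w, μ⟫_ℝ = 0 ∨ ⟪w, μ⟫_ℝ = Real.sqrt (2 / 3) ∨ ⟪w, μ⟫_ℝ = -Real.sqrt (2 / 3)) ∧
      ⟪u κ, μ⟫_ℝ = Real.sqrt (2 / 3) ∧ ∀ μ' κ', κ = μ' :: κ' → μ' ≠ -μ))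
    (hnext_pop : ∀ μ κ' (m : E3), (F (μ :: κ')).symm m = -μ → next (μ :: κ') m = κ')
    (hnext_push : ∀ κ (m : E3), (∀ μ κ', κ = μ :: κ' → (F κ).symm m ≠ -μ) → next κ m = (F κ).symm m :: κ)
    (C : E3 → Prop) (hC : ∀ μ, C μ → ⟪u [], μ⟫_ℝ = Real.sqrt (2 / 3))
    (hCall : ∀ m, IsMenuNormal (F []) m → ⟪F [] (u []), m⟫_ℝ = Real.sqrt (2 / 3) → C ((F []).symm m))
    (hPexcl0root : ∀ b : E3, b ∈ P₂ →
      (∃ a ∈ fccSlots, ∃ a' ∈ fccSlots, ∃ a'' ∈ fccSlots,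
        ⟪a, a'⟫_ℝ = 1 / 2 ∧ ⟪a, a''⟫_ℝ = 1 / 2 ∧ ⟪a', a''⟫_ℝ = 1 / 2 ∧
        b + F [] a ∈ X ∧ b + F [] a' ∈ X ∧ b + F [] a'' ∈ X) → False)
    (hup : 0 < (F [] (u [])) 2) (hR₀ : 3 ≤ R₀) (hρ : R₀ ≤ ρ)
    (L : Finset E3)
    (hLsrc : ∀ p ∈ L, p ∈ X ∧
      (∃ a ∈ fccSlots, ∃ a' ∈ fccSlots, ∃ a'' ∈ fccSlots,
        ⟪a, a'⟫_ℝ = 1 / 2 ∧ ⟪a, a''⟫_ℝ = 1 / 2 ∧ ⟪a', a''⟫_ℝ = 1 / 2 ∧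
        p + F [] a ∈ X ∧ p + F [] a' ∈ X ∧ p + F [] a'' ∈ X) ∧
      p - F [] (u []) ∈ X ∧
      (IsFull X (F []) p ∨ (∃ m, IsTwinReading X (F []) m p ∧ ⟪F [] (u []), m⟫_ℝ = 0) ∨
        (ver = WordVersion.v2 ∧ IsNarrow X (F []) (F [] (u [])) p)))
    (hLstep : ∀ p ∈ L, p + F [] (u []) ∉ L)
    (hP'top : ∀ p ∈ P', p 2 ≤ -R₀ - 1)
    (hstd : ∀ κ, WF κ → ∀ p ∈ P', (∃ a ∈ fccSlots, ∃ a' ∈ fccSlots, ∃ a'' ∈ fccSlots,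
        ⟪a, a'⟫_ℝ = 1 / 2 ∧ ⟪a, a''⟫_ℝ = 1 / 2 ∧ ⟪a', a''⟫_ℝ = 1 / 2 ∧
        p + F κ a ∈ X ∧ p + F κ a' ∈ X ∧ p + F κ a'' ∈ X) → F κ (u κ) = F [] (u []))
    (hsealB : ∀ s ∈ X, s ∉ P' → -R₀ - 1 - 1 ≤ s 2 → s 2 < -R₀ - 1 → s 0 ^ 2 + s 1 ^ 2 ≤ (ρ - 1) ^ 2 → False)
    (hP₂seal : ∀ s ∈ X, h + R₀ + 1 ≤ s 2 → s 2 ≤ h + R₀ + 1 + 1 → s 0 ^ 2 + s 1 ^ 2 ≤ (ρ - 2) ^ 2 → s ∈ P₂) :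
    ∃ T : Finset (E3 × E3),
      (L.filter fun p => -R₀ - 1 < (p + F [] (u [])) 2 ∧ (p + F [] (u [])) 2 < h + R₀ + 1).card ≤
        T.card +
        (X.filter fun b => -R₀ - 1 ≤ b 2 ∧ b 2 < h + R₀ + 1 ∧ (∃ μ, C μ ∧ IsTwinReading X (F []) (F [] μ) b) ∧ b - F [] (u []) ∈ X).card +
        (L.filter fun p => -R₀ - 1 ≤ (p - F [] (u [])) 2 ∧ (p - F [] (u [])) 2 < h + R₀ + 1 ∧ p - F [] (u []) - F [] (u []) ∈ X ∧
            (IsFull X (F []) (p - F [] (u [])) ∨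
              (∃ m, IsTwinReading X (F []) m (p - F [] (u [])) ∧ ⟪F [] (u []), m⟫_ℝ = 0) ∨
              (ver = WordVersion.v2 ∧ IsNarrow X (F []) (F [] (u [])) (p - F [] (u []))))).card +
        220 * (X.filter fun s => h + R₀ + 1 ≤ s 2 ∧ s 2 ≤ h + R₀ + 1 + 1 ∧ (ρ - 2) ^ 2 < s 0 ^ 2 + s 1 ^ 2).card +
        220 * (X.filter fun s => -R₀ - 1 - 1 ≤ s 2 ∧ s 2 < -R₀ - 1 ∧ (ρ - 1) ^ 2 < s 0 ^ 2 + s 1 ^ 2).card ∧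
      (∀ bq ∈ T, bq.1 ∈ X ∧ bq.2 ∈ X ∧ dist bq.1 bq.2 = 1 ∧ -R₀ - 1 ≤ bq.1 2 ∧ bq.1 2 < h + R₀ + 1) ∧
      (∀ bq ∈ T, (X.filter fun q => dist bq.1 q = 1).card ≤ 11 ∨
        ∃ z₁ ∈ X, ∃ z₂ ∈ X, z₁ ≠ z₂ ∧ dist bq.1 z₁ = 1 ∧ dist bq.1 z₂ = 1 ∧
          (X.filter fun q => dist z₁ q = 1).card ≤ 11 ∧ (X.filter fun q => dist z₂ q = 1).card ≤ 11) ∧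
      (∀ bq ∈ T, bq.1 - F [] (u []) ∈ X ∧ bq.2 = bq.1 - F [] (u []) ∧ ¬ IsMoving X ver (F []) (F [] (u [])) bq.1) ∧
      (∀ bq ∈ T, ∃ κ, WF κ ∧ bq.2 - F κ (u κ) ∈ X ∧ IsEndMove X ver (F κ) (F κ (u κ)) bq.2 bq.1) := by
  set P : E3 × List E3 → Prop := fun v => v.2 = [] ∧ (v.1 ∈ X ∧ v.1 - F v.2 (u v.2) ∈ X) with hPdef
  have hPstraight : ∀ (b : E3) (κ : List E3), WF κ →
      (IsFull X (F κ) b ∨ (∃ m, IsTwinReading X (F κ) m b ∧ ⟪F κ (u κ), m⟫_ℝ = 0) ∨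
        (ver = WordVersion.v2 ∧ IsNarrow X (F κ) (F κ (u κ)) b)) → P (b, κ) → P (b + F κ (u κ), κ) := by
    rintro b κ - hmv ⟨hnil, hb⟩
    exact ⟨hnil, predInv_straight hu hmv hb⟩
  have hPcross : ∀ (b : E3) (κ : List E3) (m : E3), WF κ → WF (next κ m) → IsTwinReading X (F κ) m b →
      ⟪F κ (u κ), m⟫_ℝ = Real.sqrt (2 / 3) → (κ ≠ [] ∨ ¬ C ((F []).symm m)) → P (b, κ) → P (b + F (next κ m) (u (next κ m)), next κ m) := by
    rintro b κ m - - htd hdm hoff ⟨hnil, -⟩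
    exfalso
    have hnil' : κ = [] := hnil
    subst hnil'
    rcases hoff with h0 | h0
    · exact h0 rfl
    · exact h0 (hCall m htd.1 hdm)
  have hPexcl0 : ∀ (b : E3) (κ : List E3), WF κ → P (b, κ) → b ∈ P₂ →
      (∃ a ∈ fccSlots, ∃ a' ∈ fccSlots, ∃ a'' ∈ fccSlots,
        ⟪a, a'⟫_ℝ = 1 / 2 ∧ ⟪a, a''⟫_ℝ = 1 / 2 ∧ ⟪a', a''⟫_ℝ = 1 / 2 ∧
        b + F κ a ∈ X ∧ b + F κ a' ∈ X ∧ b + F κ a'' ∈ X) → False := by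
    rintro b κ - ⟨hnil, -⟩ hb htri
    have hnil' : κ = [] := hnil
    subst hnil'
    exact hPexcl0root b hb htri
  have hLsrc' : ∀ p ∈ L, p ∈ X ∧
      (∃ a ∈ fccSlots, ∃ a' ∈ fccSlots, ∃ a'' ∈ fccSlots,
        ⟪a, a'⟫_ℝ = 1 / 2 ∧ ⟪a, a''⟫_ℝ = 1 / 2 ∧ ⟪a', a''⟫_ℝ = 1 / 2 ∧
        p + F [] a ∈ X ∧ p + F [] a' ∈ X ∧ p + F [] a'' ∈ X) ∧
      p - F [] (u []) ∈ X ∧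
      (IsFull X (F []) p ∨ (∃ m, IsTwinReading X (F []) m p ∧ ⟪F [] (u []), m⟫_ℝ = 0) ∨
        (ver = WordVersion.v2 ∧ IsNarrow X (F []) (F [] (u [])) p)) ∧
      P (p + F [] (u []), []) := by
    intro p hp
    obtain ⟨hpX, hface, hpred, hmv⟩ := hLsrc p hp
    exact ⟨hpX, hface, hpred, hmv, rfl, predInv_straight hu hmv ⟨hpX, hpred⟩⟩
  obtain ⟨T, hbound, h1, h2, h3, h4⟩ := word_family_endPairs_launch_cuts_shape ver hg hc hX hFc hu huc hWF0 hWFc hnext_pop hnext_push C hC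
    hPstraight hPcross hPexcl0 hup hR₀ hρ L hLsrc' hLstep hP'top hstd hsealB hP₂seal
  refine ⟨T, hbound.trans ?_, h1, h2, ?_, h4⟩
  · refine Nat.add_le_add_right (Nat.add_le_add_right (Nat.add_le_add (Nat.add_le_add_left (card_le_card fun b hb => ?_) _)
      (card_le_card fun p hp => ?_)) _) _
    · -- drop the invariant clause from the cut term
      simp only [Finset.mem_filter] at hb ⊢
      exact ⟨hb.1, hb.2.1, hb.2.2.1, hb.2.2.2.1, hb.2.2.2.2.2⟩
    · -- the relaunch term: the cross case is vacuous (every crossing letter is cut), the straight case reads the predecessor invariant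
      simp only [Finset.mem_filter] at hp ⊢
      obtain ⟨hpL, hrel⟩ := hp
      rcases hrel with ⟨⟨-, -, hpp⟩, hlo, hhi, hmv⟩ | ⟨μ, hwf, hne, -, -, -, m, -, -, -⟩
      · exact ⟨hpL, hlo, hhi, hpp, hmv⟩
      · obtain ⟨-, hμ1, hμmenu, hwμ, -⟩ := (hWFc μ []).1 hwf
        exact absurd (hCall (F [] μ) ⟨by rw [LinearIsometryEquiv.norm_map, hμ1], fun w hw => by
          rw [LinearIsometryEquiv.inner_map_map]; exact hμmenu w hw⟩ (by rw [LinearIsometryEquiv.inner_map_map, hwμ]))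
          (by rw [LinearIsometryEquiv.symm_apply_apply]; exact hne)
  · intro bq hbq
    obtain ⟨κ, -, ⟨hnil, -, hpred⟩, hshape, hnm⟩ := h3 bq hbq
    have hnil' : κ = [] := hnil
    subst hnil'
    exact ⟨hpred, hshape, hnm⟩

open scoped Classical in
/-- **BORN LINES have no relaunch term.**  A launch set of straight-moving root states (FULL in the root frame, say the first trackable ball above an
incoherent patch) whose predecessor `p − c` is present but is NOT itself a straight-moving state with its own predecessor present (`hborn`) is never
stepped onto by a tracked walk: with every crossing letter cut, `#L_window ≤ #T + #CUT + 220·(#rim_top + #rim_bot)`. -/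
theorem born_endPairs_launch_shape (ver : WordVersion) {δ : ℝ} (hg : KissingGap δ) (hc : KissingClassification δ)
    (hX : ∀ p ∈ X, ∀ q ∈ X, p ≠ q → 1 ≤ dist p q)
    (hFc : ∀ μ κ, F (μ :: κ) = ((ℝ ∙ μ)ᗮ.reflection).trans (F κ))
    (hu : ∀ κ, u κ ∈ fccSlots) (huc : ∀ μ κ, u (μ :: κ) = -u κ)
    (hWF0 : WF [])
    (hWFc : ∀ μ κ, WF (μ :: κ) ↔ (WF κ ∧ ‖μ‖ = 1 ∧
      (∀ w ∈ fccSlots, ⟪w, μ⟫_ℝ = 0 ∨ ⟪w, μ⟫_ℝ = Real.sqrt (2 / 3) ∨ ⟪w, μ⟫_ℝ = -Real.sqrt (2 / 3)) ∧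
      ⟪u κ, μ⟫_ℝ = Real.sqrt (2 / 3) ∧ ∀ μ' κ', κ = μ' :: κ' → μ' ≠ -μ))
    (hnext_pop : ∀ μ κ' (m : E3), (F (μ :: κ')).symm m = -μ → next (μ :: κ') m = κ')
    (hnext_push : ∀ κ (m : E3), (∀ μ κ', κ = μ :: κ' → (F κ).symm m ≠ -μ) → next κ m = (F κ).symm m :: κ)
    (C : E3 → Prop) (hC : ∀ μ, C μ → ⟪u [], μ⟫_ℝ = Real.sqrt (2 / 3))
    (hCall : ∀ m, IsMenuNormal (F []) m → ⟪F [] (u []), m⟫_ℝ = Real.sqrt (2 / 3) → C ((F []).symm m))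
    (hPexcl0root : ∀ b : E3, b ∈ P₂ →
      (∃ a ∈ fccSlots, ∃ a' ∈ fccSlots, ∃ a'' ∈ fccSlots,
        ⟪a, a'⟫_ℝ = 1 / 2 ∧ ⟪a, a''⟫_ℝ = 1 / 2 ∧ ⟪a', a''⟫_ℝ = 1 / 2 ∧
        b + F [] a ∈ X ∧ b + F [] a' ∈ X ∧ b + F [] a'' ∈ X) → False)
    (hup : 0 < (F [] (u [])) 2) (hR₀ : 3 ≤ R₀) (hρ : R₀ ≤ ρ)
    -- the BORN launch set: full root-frame balls with predecessor present, the predecessor NOT a trackable straight mover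
    (L : Finset E3)
    (hborn : ∀ p ∈ L, p ∈ X ∧ IsFull X (F []) p ∧ p - F [] (u []) ∈ X ∧
      ¬ (p - F [] (u []) - F [] (u []) ∈ X ∧
        (IsFull X (F []) (p - F [] (u [])) ∨ (∃ m, IsTwinReading X (F []) m (p - F [] (u [])) ∧ ⟪F [] (u []), m⟫_ℝ = 0) ∨
          (ver = WordVersion.v2 ∧ IsNarrow X (F []) (F [] (u [])) (p - F [] (u []))))))
    (hP'top : ∀ p ∈ P', p 2 ≤ -R₀ - 1)
    (hstd : ∀ κ, WF κ → ∀ p ∈ P', (∃ a ∈ fccSlots, ∃ a' ∈ fccSlots, ∃ a'' ∈ fccSlots,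
        ⟪a, a'⟫_ℝ = 1 / 2 ∧ ⟪a, a''⟫_ℝ = 1 / 2 ∧ ⟪a', a''⟫_ℝ = 1 / 2 ∧
        p + F κ a ∈ X ∧ p + F κ a' ∈ X ∧ p + F κ a'' ∈ X) → F κ (u κ) = F [] (u []))
    (hsealB : ∀ s ∈ X, s ∉ P' → -R₀ - 1 - 1 ≤ s 2 → s 2 < -R₀ - 1 → s 0 ^ 2 + s 1 ^ 2 ≤ (ρ - 1) ^ 2 → False)
    (hP₂seal : ∀ s ∈ X, h + R₀ + 1 ≤ s 2 → s 2 ≤ h + R₀ + 1 + 1 → s 0 ^ 2 + s 1 ^ 2 ≤ (ρ - 2) ^ 2 → s ∈ P₂) :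
    ∃ T : Finset (E3 × E3),
      (L.filter fun p => -R₀ - 1 < (p + F [] (u [])) 2 ∧ (p + F [] (u [])) 2 < h + R₀ + 1).card ≤
        T.card +
        (X.filter fun b => -R₀ - 1 ≤ b 2 ∧ b 2 < h + R₀ + 1 ∧ (∃ μ, C μ ∧ IsTwinReading X (F []) (F [] μ) b) ∧ b - F [] (u []) ∈ X).card +
        220 * (X.filter fun s => h + R₀ + 1 ≤ s 2 ∧ s 2 ≤ h + R₀ + 1 + 1 ∧ (ρ - 2) ^ 2 < s 0 ^ 2 + s 1 ^ 2).card +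
        220 * (X.filter fun s => -R₀ - 1 - 1 ≤ s 2 ∧ s 2 < -R₀ - 1 ∧ (ρ - 1) ^ 2 < s 0 ^ 2 + s 1 ^ 2).card ∧
      (∀ bq ∈ T, bq.1 ∈ X ∧ bq.2 ∈ X ∧ dist bq.1 bq.2 = 1 ∧ -R₀ - 1 ≤ bq.1 2 ∧ bq.1 2 < h + R₀ + 1) ∧
      (∀ bq ∈ T, (X.filter fun q => dist bq.1 q = 1).card ≤ 11 ∨
        ∃ z₁ ∈ X, ∃ z₂ ∈ X, z₁ ≠ z₂ ∧ dist bq.1 z₁ = 1 ∧ dist bq.1 z₂ = 1 ∧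
          (X.filter fun q => dist z₁ q = 1).card ≤ 11 ∧ (X.filter fun q => dist z₂ q = 1).card ≤ 11) ∧
      (∀ bq ∈ T, bq.1 - F [] (u []) ∈ X ∧ bq.2 = bq.1 - F [] (u []) ∧ ¬ IsMoving X ver (F []) (F [] (u [])) bq.1) ∧
      (∀ bq ∈ T, ∃ κ, WF κ ∧ bq.2 - F κ (u κ) ∈ X ∧ IsEndMove X ver (F κ) (F κ (u κ)) bq.2 bq.1) := by
  have hLsrc : ∀ p ∈ L, p ∈ X ∧
      (∃ a ∈ fccSlots, ∃ a' ∈ fccSlots, ∃ a'' ∈ fccSlots,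
        ⟪a, a'⟫_ℝ = 1 / 2 ∧ ⟪a, a''⟫_ℝ = 1 / 2 ∧ ⟪a', a''⟫_ℝ = 1 / 2 ∧
        p + F [] a ∈ X ∧ p + F [] a' ∈ X ∧ p + F [] a'' ∈ X) ∧
      p - F [] (u []) ∈ X ∧
      (IsFull X (F []) p ∨ (∃ m, IsTwinReading X (F []) m p ∧ ⟪F [] (u []), m⟫_ℝ = 0) ∨
        (ver = WordVersion.v2 ∧ IsNarrow X (F []) (F [] (u [])) p)) := by
    intro p hp
    obtain ⟨hpX, hfull, hpred, -⟩ := hborn p hp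
    exact ⟨hpX, face_of_isFull (F []) hfull, hpred, Or.inl hfull⟩
  -- a full ball's successor is never a born launch (its predecessor would be a trackable straight mover)
  have hLstep : ∀ p ∈ L, p + F [] (u []) ∉ L := by
    intro p hp hmem
    obtain ⟨hpX, hfull, hpred, -⟩ := hborn p hp
    obtain ⟨-, -, -, hno⟩ := hborn _ hmem
    rw [add_sub_cancel_right] at hno
    exact hno ⟨hpred, Or.inl hfull⟩
  obtain ⟨T, hbound, h1, h2, h3, h4⟩ := rootClass_endPairs_launch_shape ver hg hc hX hFc hu huc hWF0 hWFc hnext_pop hnext_push C hC hCall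
    hPexcl0root hup hR₀ hρ L hLsrc hLstep hP'top hstd hsealB hP₂seal
  refine ⟨T, hbound.trans ?_, h1, h2, h3, h4⟩
  -- the straight relaunch term is EMPTY for born launches
  rw [Finset.card_eq_zero.2 ((Finset.filter_eq_empty_iff (s := L)).2 ?_), add_zero]
  intro p hp hrel
  obtain ⟨-, -, -, hno⟩ := hborn p hp
  exact hno ⟨hrel.2.2.1, hrel.2.2.2⟩

open scoped Classical in
/-- **BORN LINES with any straight-moving launch ball** (FULL, or a GLIDE reading, or — version `v2` — NARROW): the born basal GLIDE lines of an hcp-like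
lamella are the ones that exist on edge-on cells (memo §4(c)).  Launch balls: in `X`, straight-moving along the root, an occupied root-frame face, predecessor
present but NOT a trackable straight mover with its own predecessor (`hborn`).  No relaunch term: `#L_window ≤ #T + #CUT + 220·(#rim_top + #rim_bot)`. -/
theorem bornMoving_endPairs_launch_shape (ver : WordVersion) {δ : ℝ} (hg : KissingGap δ) (hc : KissingClassification δ)
    (hX : ∀ p ∈ X, ∀ q ∈ X, p ≠ q → 1 ≤ dist p q)
    (hFc : ∀ μ κ, F (μ :: κ) = ((ℝ ∙ μ)ᗮ.reflection).trans (F κ))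
    (hu : ∀ κ, u κ ∈ fccSlots) (huc : ∀ μ κ, u (μ :: κ) = -u κ)
    (hWF0 : WF [])
    (hWFc : ∀ μ κ, WF (μ :: κ) ↔ (WF κ ∧ ‖μ‖ = 1 ∧
      (∀ w ∈ fccSlots, ⟪w, μ⟫_ℝ = 0 ∨ ⟪w, μ⟫_ℝ = Real.sqrt (2 / 3) ∨ ⟪w, μ⟫_ℝ = -Real.sqrt (2 / 3)) ∧
      ⟪u κ, μ⟫_ℝ = Real.sqrt (2 / 3) ∧ ∀ μ' κ', κ = μ' :: κ' → μ' ≠ -μ))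
    (hnext_pop : ∀ μ κ' (m : E3), (F (μ :: κ')).symm m = -μ → next (μ :: κ') m = κ')
    (hnext_push : ∀ κ (m : E3), (∀ μ κ', κ = μ :: κ' → (F κ).symm m ≠ -μ) → next κ m = (F κ).symm m :: κ)
    (C : E3 → Prop) (hC : ∀ μ, C μ → ⟪u [], μ⟫_ℝ = Real.sqrt (2 / 3))
    (hCall : ∀ m, IsMenuNormal (F []) m → ⟪F [] (u []), m⟫_ℝ = Real.sqrt (2 / 3) → C ((F []).symm m))
    (hPexcl0root : ∀ b : E3, b ∈ P₂ →
      (∃ a ∈ fccSlots, ∃ a' ∈ fccSlots, ∃ a'' ∈ fccSlots,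
        ⟪a, a'⟫_ℝ = 1 / 2 ∧ ⟪a, a''⟫_ℝ = 1 / 2 ∧ ⟪a', a''⟫_ℝ = 1 / 2 ∧
        b + F [] a ∈ X ∧ b + F [] a' ∈ X ∧ b + F [] a'' ∈ X) → False)
    (hup : 0 < (F [] (u [])) 2) (hR₀ : 3 ≤ R₀) (hρ : R₀ ≤ ρ)
    (L : Finset E3)
    (hborn : ∀ p ∈ L, p ∈ X ∧
      (IsFull X (F []) p ∨ (∃ m, IsTwinReading X (F []) m p ∧ ⟪F [] (u []), m⟫_ℝ = 0) ∨
        (ver = WordVersion.v2 ∧ IsNarrow X (F []) (F [] (u [])) p)) ∧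
      (∃ a ∈ fccSlots, ∃ a' ∈ fccSlots, ∃ a'' ∈ fccSlots,
        ⟪a, a'⟫_ℝ = 1 / 2 ∧ ⟪a, a''⟫_ℝ = 1 / 2 ∧ ⟪a', a''⟫_ℝ = 1 / 2 ∧
        p + F [] a ∈ X ∧ p + F [] a' ∈ X ∧ p + F [] a'' ∈ X) ∧
      p - F [] (u []) ∈ X ∧
      ¬ (p - F [] (u []) - F [] (u []) ∈ X ∧
        (IsFull X (F []) (p - F [] (u [])) ∨ (∃ m, IsTwinReading X (F []) m (p - F [] (u [])) ∧ ⟪F [] (u []), m⟫_ℝ = 0) ∨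
          (ver = WordVersion.v2 ∧ IsNarrow X (F []) (F [] (u [])) (p - F [] (u []))))))
    (hP'top : ∀ p ∈ P', p 2 ≤ -R₀ - 1)
    (hstd : ∀ κ, WF κ → ∀ p ∈ P', (∃ a ∈ fccSlots, ∃ a' ∈ fccSlots, ∃ a'' ∈ fccSlots,
        ⟪a, a'⟫_ℝ = 1 / 2 ∧ ⟪a, a''⟫_ℝ = 1 / 2 ∧ ⟪a', a''⟫_ℝ = 1 / 2 ∧
        p + F κ a ∈ X ∧ p + F κ a' ∈ X ∧ p + F κ a'' ∈ X) → F κ (u κ) = F [] (u []))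
    (hsealB : ∀ s ∈ X, s ∉ P' → -R₀ - 1 - 1 ≤ s 2 → s 2 < -R₀ - 1 → s 0 ^ 2 + s 1 ^ 2 ≤ (ρ - 1) ^ 2 → False)
    (hP₂seal : ∀ s ∈ X, h + R₀ + 1 ≤ s 2 → s 2 ≤ h + R₀ + 1 + 1 → s 0 ^ 2 + s 1 ^ 2 ≤ (ρ - 2) ^ 2 → s ∈ P₂) :
    ∃ T : Finset (E3 × E3),
      (L.filter fun p => -R₀ - 1 < (p + F [] (u [])) 2 ∧ (p + F [] (u [])) 2 < h + R₀ + 1).card ≤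
        T.card +
        (X.filter fun b => -R₀ - 1 ≤ b 2 ∧ b 2 < h + R₀ + 1 ∧ (∃ μ, C μ ∧ IsTwinReading X (F []) (F [] μ) b) ∧ b - F [] (u []) ∈ X).card +
        220 * (X.filter fun s => h + R₀ + 1 ≤ s 2 ∧ s 2 ≤ h + R₀ + 1 + 1 ∧ (ρ - 2) ^ 2 < s 0 ^ 2 + s 1 ^ 2).card +
        220 * (X.filter fun s => -R₀ - 1 - 1 ≤ s 2 ∧ s 2 < -R₀ - 1 ∧ (ρ - 1) ^ 2 < s 0 ^ 2 + s 1 ^ 2).card ∧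
      (∀ bq ∈ T, bq.1 ∈ X ∧ bq.2 ∈ X ∧ dist bq.1 bq.2 = 1 ∧ -R₀ - 1 ≤ bq.1 2 ∧ bq.1 2 < h + R₀ + 1) ∧
      (∀ bq ∈ T, (X.filter fun q => dist bq.1 q = 1).card ≤ 11 ∨
        ∃ z₁ ∈ X, ∃ z₂ ∈ X, z₁ ≠ z₂ ∧ dist bq.1 z₁ = 1 ∧ dist bq.1 z₂ = 1 ∧
          (X.filter fun q => dist z₁ q = 1).card ≤ 11 ∧ (X.filter fun q => dist z₂ q = 1).card ≤ 11) ∧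
      (∀ bq ∈ T, bq.1 - F [] (u []) ∈ X ∧ bq.2 = bq.1 - F [] (u []) ∧ ¬ IsMoving X ver (F []) (F [] (u [])) bq.1) ∧
      (∀ bq ∈ T, ∃ κ, WF κ ∧ bq.2 - F κ (u κ) ∈ X ∧ IsEndMove X ver (F κ) (F κ (u κ)) bq.2 bq.1) := by
  have hLsrc : ∀ p ∈ L, p ∈ X ∧
      (∃ a ∈ fccSlots, ∃ a' ∈ fccSlots, ∃ a'' ∈ fccSlots,
        ⟪a, a'⟫_ℝ = 1 / 2 ∧ ⟪a, a''⟫_ℝ = 1 / 2 ∧ ⟪a', a''⟫_ℝ = 1 / 2 ∧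
        p + F [] a ∈ X ∧ p + F [] a' ∈ X ∧ p + F [] a'' ∈ X) ∧
      p - F [] (u []) ∈ X ∧
      (IsFull X (F []) p ∨ (∃ m, IsTwinReading X (F []) m p ∧ ⟪F [] (u []), m⟫_ℝ = 0) ∨
        (ver = WordVersion.v2 ∧ IsNarrow X (F []) (F [] (u [])) p)) := by
    intro p hp
    obtain ⟨hpX, hmv, hface, hpred, -⟩ := hborn p hp
    exact ⟨hpX, hface, hpred, hmv⟩
  have hLstep : ∀ p ∈ L, p + F [] (u []) ∉ L := by
    intro p hp hmem
    obtain ⟨-, hmv, -, hpred, -⟩ := hborn p hp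
    obtain ⟨-, -, -, -, hno⟩ := hborn _ hmem
    rw [add_sub_cancel_right] at hno
    exact hno ⟨hpred, hmv⟩
  obtain ⟨T, hbound, h1, h2, h3, h4⟩ := rootClass_endPairs_launch_shape ver hg hc hX hFc hu huc hWF0 hWFc hnext_pop hnext_push C hC hCall
    hPexcl0root hup hR₀ hρ L hLsrc hLstep hP'top hstd hsealB hP₂seal
  refine ⟨T, hbound.trans ?_, h1, h2, h3, h4⟩
  rw [Finset.card_eq_zero.2 ((Finset.filter_eq_empty_iff (s := L)).2 ?_), add_zero]
  intro p hp hrel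
  obtain ⟨-, -, -, -, hno⟩ := hborn p hp
  exact hno ⟨hrel.2.2.1, hrel.2.2.2⟩

end RootLaunch

end Summit.Ventures.Crystal3D.Theorems

end
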